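import Literature.AlgebraicGeometry.Motives.FamiliesVHS
import HarnessLib

/-!
# Tubes and flat families of subspaces of the cohomology of the fibres of a family

For a morphism `f : 𝒳 ⟶ U` of `ℂ`-schemes this file sets up the *tube-flatness vocabulary*, in
which sub-local systems of `Rⁿ f(ℂ)_* ℚ` are rendered on the tree's real singular cohomology of
complex points (`bettiCohomology`, `singularCohomology ℚ ℚ`), with nothing posited:

* `tube f V` (`V ⊆ U(ℂ)`) — the subspace `f(ℂ)⁻¹(V) ⊆ 𝒳(ℂ)` of complex points lying on a fibre
  `𝒳_s(ℂ)`, `s ∈ V` (Voisin, *Hodge Theory I*, §9.1.1–§9.2.1: `π⁻¹(U)`, `X_0 × B_0`), spelled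
  through `fiberι` so that the membership witness of a point of a fibre is `rfl`; the continuous
  inclusions `fiberToTube`, `tubeIncl` (`V ⊆ W`), `tubeVal` (into `𝒳(ℂ)`);
* `tubeRestrict f n V s hs : Hⁿ(tube f V; ℚ) ⟶ Hⁿ_B(𝒳_s)` — restriction to the fibre over `s ∈ V`
  (the map `Hᵏ(π⁻¹(B₀), A) → Hᵏ(X_t, A)` of Voisin I, §9.2.1);
* `IsFlatSubfamily f n L` — `t ↦ L_t ⊆ Hⁿ_B(𝒳_t)` is locally the injective image of ONE subspace
  `N ⊆ Hⁿ(tube f V; ℚ)` under the restrictions (a sub-local system of `Rⁿ f_* ℚ`; Voisin I,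
  Def. 9.8, §9.2.1); `IsFlatHom f g n n' L L' φ` (a morphism of sub-local systems, for two
  families over the same base), `IsFlatEnd`, `flatEndSpan` (`ℚ`-span of the flat endomorphism
  families), `IsFlatIrreducible` (no flat subfamily besides `0` and `L`);
* `localInvariants f n L W t ht` — the classes of `L_t` extending over the tube above `W ∋ t`
  (over the preimage of a punctured neighbourhood of a puncture: the local-monodromy invariants),
  `LocalInvariantCodimLE f n L j s₁ d` (their codimension in `L_t` is `≤ d` near `s₁ ∈ P(ℂ)`,
  `j : U ⟶ P`);
* `HasFiniteMonodromy f n L` — a flat family of *finite* spanning sets `F_t ⊆ L_t`;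
* `IsFlatSection f n y` — `(y_s)_s` is locally the restriction of one tube class (a global section
  of `Rⁿ f(ℂ)_* ℚ`; Voisin II, §4.3.1); restrictions of a global class are flat sections;
* named facts `Voisin2002_tubeRestrict_isIso` (Ehresmann + contractible neighbourhoods: over small
  neighbourhoods the tube restrictions are isomorphisms; Voisin I, Thm. 9.3, §9.2.1) and
  `Voisin2003_invariantCycles` (Deligne; Voisin II, Thm. 4.18: for a smooth projective morphism
  every global section of `Rⁿ f_* ℚ` is the restriction of a class on the total space).

## Design
`GeometricVHSData` (file `FamiliesVHS`) posits a local system with fibres `Hⁱ(𝒳_s)` whose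
transport is constrained only on restrictions of global classes, so irreducibility / rigidity /
finite-monodromy hypotheses stated against it are satisfiable by junk transport. Here all data are
honest cohomology groups of subspaces of `𝒳(ℂ)` and honest restriction maps; granted
`Voisin2002_tubeRestrict_isIso` and homotopy invariance, a flat subfamily is exactly a family of
subspaces stable under parallel transport. Absent that fact the predicates are *renderings*:
`HasFiniteMonodromy` (injectivity asked on the finite set only) does not by itself give
`IsFlatSubfamily`, and `IsFlatIrreducible` does not ask `L` to be flat — users conjoin what they
need. The clauses are copied from the inline spelling used by the Hodge-summit route items that
requested them, and the long forms are *definitionally* the short ones (`Iff.rfl`, checked in a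
scratch file against `KatzUnwinding.KummerEndgame` / `HypergeometricComparison`).

## Mathlib / tree search
Mathlib has no local systems, no `R f_*` of constant sheaves on complex points, no Ehresmann
theorem (searched `LocalSystem`, `Ehresmann`, `locallyTrivial`, `GaussManin`; `FiberBundle` is
data). The tree's `LocalSystem` (functor on `Π₁`, file `LocalSystems`) has no construction of
`Rⁿ f_* ℚ` for a family. Used as they are: `fiberOver`, `fiberι`, `IsSmoothProjectiveFamily`
(`FamiliesVHS`), `bettiCohomology` (`BettiRealization`), `singularCohomology.map`
(`SingularCochains`), `AlgPoints.mapContinuous` (`AlgPoints`), Mathlib `Smooth`, `IsProper`,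
`IsSeparated`, `IsClosedImmersion`.

## Not here
A `LocalSystem ℚ (ComplexPoints U)` model of `Rⁿ f_* ℚ` built from tubes and the equivalence
"flat subfamily ↔ sub-local system"; the Hodge-theoretic half of the theorem of the fixed part
(Deligne 1971, 4.1.1; Voisin II, Thm. 4.24, Cor. 4.25), which needs a smooth compactification.

## References
* C. Voisin, *Hodge Theory and Complex Algebraic Geometry I*, CUP 2002, Thm. 9.3, Def. 9.8, §9.2.1.
* C. Voisin, *Hodge Theory and Complex Algebraic Geometry II*, CUP 2003, Def. 4.14, Thm. 4.15,
  Lemma 4.17, Thm. 4.18, Thm. 4.24.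
* P. Deligne, *Théorie de Hodge II*, Publ. Math. IHÉS 40 (1971), §4.1.
-/

noncomputable section

open CategoryTheory AlgebraicGeometry MonoidalCategory
open Literature.AlgebraicTopology.SingularHomology
open scoped Topology

namespace Literature.AlgebraicGeometry.Motives

variable {U 𝒳 𝒦 : SchemeOver ℂ}

/-- The **tube** of `f : 𝒳 ⟶ U` over `V ⊆ U(ℂ)`: the complex points of `𝒳` lying on some fibre
`𝒳_s(ℂ)` with `s ∈ V`, i.e. the subspace `f(ℂ)⁻¹(V)` of `𝒳(ℂ)` with the induced (analytic) topology
(Voisin I, §9.1.1: `φ⁻¹(U)`; §9.2.1: `π⁻¹(U)`). Spelled through `fiberι`, so that for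
`x ∈ 𝒳_s(ℂ)` the membership witness is `⟨s, hs, x, rfl⟩`. [folklore] -/
abbrev tube (f : 𝒳 ⟶ U) (V : Set (ComplexPoints U)) : Type :=
  {y : ComplexPoints 𝒳 //
    ∃ s ∈ V, ∃ x : ComplexPoints (fiberOver f s), AlgPoints.map (fiberι f s) x = y}

/-- The inclusion of the fibre `𝒳_s(ℂ)`, `s ∈ V`, into the tube over `V`, as a continuous map
(continuity of `fiberι(ℂ)`: `AlgPoints.mapContinuous`). [folklore] -/
def fiberToTube (f : 𝒳 ⟶ U) (V : Set (ComplexPoints U)) (s : ComplexPoints U) (hs : s ∈ V) :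
    C(ComplexPoints (fiberOver f s), tube f V) :=
  ⟨fun x => ⟨AlgPoints.map (fiberι f s) x, s, hs, x, rfl⟩,
    (AlgPoints.mapContinuous (L := ℂ) (fiberι f s)).continuous.subtype_mk _⟩

/-- `fiberToTube` on points is `fiberι(ℂ)`. [folklore] -/
@[simp]
theorem fiberToTube_apply_coe (f : 𝒳 ⟶ U) (V : Set (ComplexPoints U)) (s : ComplexPoints U)
    (hs : s ∈ V) (x : ComplexPoints (fiberOver f s)) :
    ((fiberToTube f V s hs x : tube f V) : ComplexPoints 𝒳) = AlgPoints.map (fiberι f s) x := rfl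

/-- The inclusion of tubes `tube f V → tube f W` for `V ⊆ W`. [folklore] -/
def tubeIncl (f : 𝒳 ⟶ U) {V W : Set (ComplexPoints U)} (h : V ⊆ W) : C(tube f V, tube f W) :=
  ⟨fun y => ⟨y.1, y.2.imp fun _ hs => ⟨h hs.1, hs.2⟩⟩, continuous_subtype_val.subtype_mk _⟩

/-- The inclusion of a tube into all complex points `tube f V → 𝒳(ℂ)`. [folklore] -/
def tubeVal (f : 𝒳 ⟶ U) (V : Set (ComplexPoints U)) : C(tube f V, ComplexPoints 𝒳) :=
  ⟨Subtype.val, continuous_subtype_val⟩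

/-- Fibre ↪ smaller tube ↪ larger tube is fibre ↪ larger tube. [folklore] -/
theorem tubeIncl_comp_fiberToTube (f : 𝒳 ⟶ U) {V W : Set (ComplexPoints U)} (h : V ⊆ W)
    (s : ComplexPoints U) (hs : s ∈ V) :
    (tubeIncl f h).comp (fiberToTube f V s hs) = fiberToTube f W s (h hs) := rfl

/-- Including a fibre into a tube and then into `𝒳(ℂ)` is `fiberι(ℂ)`. [folklore] -/
theorem tubeVal_comp_fiberToTube (f : 𝒳 ⟶ U) (V : Set (ComplexPoints U)) (s : ComplexPoints U)
    (hs : s ∈ V) :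
    (tubeVal f V).comp (fiberToTube f V s hs) = AlgPoints.mapContinuous (L := ℂ) (fiberι f s) := rfl

/-- **Restriction from a tube to a fibre**: `Hⁿ(tube f V; ℚ) ⟶ Hⁿ_B(𝒳_s) = Hⁿ(𝒳_s(ℂ); ℚ)` for
`s ∈ V`, the pull-back along `fiberToTube` (the restriction `Hᵏ(π⁻¹(B₀), A) → Hᵏ(X_t, A)` of
Voisin I, §9.2.1, which identifies the stalk of `Rᵏ π_* A` at `t` with `Hᵏ(X_t, A)`). [folklore] -/
def tubeRestrict (f : 𝒳 ⟶ U) (n : ℕ) (V : Set (ComplexPoints U)) (s : ComplexPoints U)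
    (hs : s ∈ V) : singularCohomology ℚ ℚ (tube f V) n ⟶ bettiCohomology (fiberOver f s) n :=
  singularCohomology.map ℚ ℚ (fiberToTube f V s hs) n

/-- `tubeRestrict` unfolded. [folklore] -/
theorem tubeRestrict_def (f : 𝒳 ⟶ U) (n : ℕ) (V : Set (ComplexPoints U)) (s : ComplexPoints U)
    (hs : s ∈ V) :
    tubeRestrict f n V s hs = singularCohomology.map ℚ ℚ (fiberToTube f V s hs) n := rfl

/-- Restriction from a larger tube factors through the smaller tube:
`(tube f V ↪ tube f W)^* ≫ res_V = res_W`. [folklore] -/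
theorem map_tubeIncl_comp_tubeRestrict (f : 𝒳 ⟶ U) (n : ℕ) {V W : Set (ComplexPoints U)}
    (h : V ⊆ W) (s : ComplexPoints U) (hs : s ∈ V) :
    singularCohomology.map ℚ ℚ (tubeIncl f h) n ≫ tubeRestrict f n V s hs =
      tubeRestrict f n W s (h hs) := by
  rw [tubeRestrict_def, tubeRestrict_def, ← singularCohomology.map_comp, tubeIncl_comp_fiberToTube]

/-- Pointwise form of `map_tubeIncl_comp_tubeRestrict`. [folklore] -/
theorem tubeRestrict_map_tubeIncl_apply (f : 𝒳 ⟶ U) (n : ℕ) {V W : Set (ComplexPoints U)}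
    (h : V ⊆ W) (s : ComplexPoints U) (hs : s ∈ V) (x : singularCohomology ℚ ℚ (tube f W) n) :
    (tubeRestrict f n V s hs).hom ((singularCohomology.map ℚ ℚ (tubeIncl f h) n).hom x) =
      (tubeRestrict f n W s (h hs)).hom x := by
  rw [← LinearMap.comp_apply, ← ModuleCat.hom_comp, map_tubeIncl_comp_tubeRestrict]

/-- Restricting a global class `z ∈ Hⁿ(𝒳(ℂ); ℚ)` to a tube and then to a fibre is pulling it back
along `fiberι`. [folklore] -/
theorem tubeRestrict_map_tubeVal_apply (f : 𝒳 ⟶ U) (n : ℕ) (V : Set (ComplexPoints U))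
    (s : ComplexPoints U) (hs : s ∈ V) (z : bettiCohomology 𝒳 n) :
    (tubeRestrict f n V s hs).hom ((singularCohomology.map ℚ ℚ (tubeVal f V) n).hom z) =
      (bettiCohomology.map (fiberι f s) n).hom z := by
  rw [← LinearMap.comp_apply, ← ModuleCat.hom_comp, tubeRestrict_def,
    ← singularCohomology.map_comp, tubeVal_comp_fiberToTube]

/-- A family `t ↦ L_t ⊆ Hⁿ_B(𝒳_t)` of subspaces of the rational cohomology of the fibres of
`f : 𝒳 ⟶ U` **is a flat subfamily** if every `t₀ ∈ U(ℂ)` has a neighbourhood `V` and a subspace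
`N ⊆ Hⁿ(tube f V; ℚ)` which the restriction to each fibre `𝒳_t`, `t ∈ V`, maps injectively onto
`L_t` — a sub-local system of `Rⁿ f_* ℚ` (Voisin I, Def. 9.8 with §9.2.1: `Rᵏ π_* A` is locally
the constant sheaf `Hᵏ(X_0 × B_0, A) ≅ Hᵏ(X_t, A)`), rendered on tubes. Meaningful (equivalent to
stability under parallel transport) under `Voisin2002_tubeRestrict_isIso`. [folklore] -/
def IsFlatSubfamily (f : 𝒳 ⟶ U) (n : ℕ)
    (L : ∀ t : ComplexPoints U, Submodule ℚ (bettiCohomology (fiberOver f t) n)) : Prop :=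
  ∀ t₀ : ComplexPoints U, ∃ V ∈ 𝓝 t₀, ∃ N : Submodule ℚ (singularCohomology ℚ ℚ (tube f V) n),
    ∀ (t : ComplexPoints U) (ht : t ∈ V),
      Submodule.map (tubeRestrict f n V t ht).hom N = L t ∧
        ∀ x ∈ N, (tubeRestrict f n V t ht).hom x = 0 → x = 0

/-- A family of linear maps `φ_t : L_t → L'_t` between families of subspaces of `Hⁿ_B(𝒳_t)` and
`Hⁿ'_B(𝒦_t)`, for two families `f : 𝒳 ⟶ U`, `g : 𝒦 ⟶ U` over the same base, **is flat** (a
morphism of sub-local systems of `Rⁿ f_* ℚ`, `Rⁿ' g_* ℚ`; Voisin I, §9.2.1) if locally on `U(ℂ)`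
both families are cut out injectively by subspaces `N`, `N'` of the cohomology of the tubes over
one `V` and `φ_t ∘ res_t = res_t ∘ Φ` on `N` for one linear map `Φ : N → N'`. [folklore] -/
def IsFlatHom (f : 𝒳 ⟶ U) (g : 𝒦 ⟶ U) (n n' : ℕ)
    (L : ∀ t : ComplexPoints U, Submodule ℚ (bettiCohomology (fiberOver f t) n))
    (L' : ∀ t : ComplexPoints U, Submodule ℚ (bettiCohomology (fiberOver g t) n'))
    (φ : ∀ t, L t →ₗ[ℚ] L' t) : Prop :=
  ∀ t₀ : ComplexPoints U, ∃ V ∈ 𝓝 t₀,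
    ∃ (N : Submodule ℚ (singularCohomology ℚ ℚ (tube f V) n))
      (N' : Submodule ℚ (singularCohomology ℚ ℚ (tube g V) n')) (Φ : N →ₗ[ℚ] N'),
      ∀ (t : ComplexPoints U) (ht : t ∈ V),
        Submodule.map (tubeRestrict f n V t ht).hom N = L t ∧
        (∀ x ∈ N, (tubeRestrict f n V t ht).hom x = 0 → x = 0) ∧
        Submodule.map (tubeRestrict g n' V t ht).hom N' = L' t ∧
        (∀ x ∈ N', (tubeRestrict g n' V t ht).hom x = 0 → x = 0) ∧
        ∀ (x : N) (hx : (tubeRestrict f n V t ht).hom x ∈ L t),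
          (φ t ⟨(tubeRestrict f n V t ht).hom x, hx⟩).1 = (tubeRestrict g n' V t ht).hom (Φ x)

/-- A family of endomorphisms `ψ_t : L_t → L_t` **is flat** if locally on `U(ℂ)` the family `L` is
cut out injectively by one subspace `N` of the cohomology of the tube and `ψ_t ∘ res_t = res_t ∘ Ψ`
on `N` for one `Ψ : N → N` (an endomorphism of the sub-local system; Voisin I, §9.2.1). This is the
one-subspace form; it implies `IsFlatHom f f n n L L ψ` (`IsFlatEnd.isFlatHom`). [folklore] -/
def IsFlatEnd (f : 𝒳 ⟶ U) (n : ℕ)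
    (L : ∀ t : ComplexPoints U, Submodule ℚ (bettiCohomology (fiberOver f t) n))
    (ψ : ∀ t, L t →ₗ[ℚ] L t) : Prop :=
  ∀ t₀ : ComplexPoints U, ∃ V ∈ 𝓝 t₀,
    ∃ (N : Submodule ℚ (singularCohomology ℚ ℚ (tube f V) n)) (Ψ : N →ₗ[ℚ] N),
      ∀ (t : ComplexPoints U) (ht : t ∈ V),
        Submodule.map (tubeRestrict f n V t ht).hom N = L t ∧
        (∀ x ∈ N, (tubeRestrict f n V t ht).hom x = 0 → x = 0) ∧
        ∀ (x : N) (hx : (tubeRestrict f n V t ht).hom x ∈ L t),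
          (ψ t ⟨(tubeRestrict f n V t ht).hom x, hx⟩).1 = (tubeRestrict f n V t ht).hom (Ψ x)

/-- The **span of the flat endomorphism families** `End_flat(L) ⊗ ℚ`: the `ℚ`-subspace of
`∏_t End(L_t)` spanned by the flat families of endomorphisms (the endomorphism algebra of the
sub-local system; Voisin I, §9.2.1). [folklore] -/
def flatEndSpan (f : 𝒳 ⟶ U) (n : ℕ)
    (L : ∀ t : ComplexPoints U, Submodule ℚ (bettiCohomology (fiberOver f t) n)) :
    Submodule ℚ (∀ t, L t →ₗ[ℚ] L t) :=
  Submodule.span ℚ {ψ | IsFlatEnd f n L ψ}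

/-- The family `L` **is flat-irreducible**: every flat subfamily `L₁ ≤ L` is `0` at every fibre or
all of `L` at every fibre (irreducible local system: Voisin II, §3.2.3, Def. 3.26, with Cor. 3.10
identifying sub-local systems and monodromy-stable subspaces). Does not itself ask `L` to be
flat or nonzero; conjoin `IsFlatSubfamily f n L` when needed. [folklore] -/
def IsFlatIrreducible (f : 𝒳 ⟶ U) (n : ℕ)
    (L : ∀ t : ComplexPoints U, Submodule ℚ (bettiCohomology (fiberOver f t) n)) : Prop :=
  ∀ L₁ : ∀ t : ComplexPoints U, Submodule ℚ (bettiCohomology (fiberOver f t) n),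
    (∀ t, L₁ t ≤ L t) → IsFlatSubfamily f n L₁ → (∀ t, L₁ t = ⊥) ∨ (∀ t, L₁ t = L t)

/-- The **invariants of `L_t` over `W`**: the classes of `L_t` that extend to the tube above
`W ∋ t`. For `W = (j(ℂ))⁻¹(O')` with `O'` a small neighbourhood of a puncture `s₁` of `U` inside a
compactification `j : U ⟶ P`, these are the local-monodromy invariants of `L` at `s₁` seen in the
nearby fibre `𝒳_t` (Voisin II, Lemma 4.17: sections over an arcwise connected base = invariants of
the monodromy). [folklore] -/
def localInvariants (f : 𝒳 ⟶ U) (n : ℕ)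
    (L : ∀ t : ComplexPoints U, Submodule ℚ (bettiCohomology (fiberOver f t) n))
    (W : Set (ComplexPoints U)) (t : ComplexPoints U) (ht : t ∈ W) :
    Submodule ℚ (bettiCohomology (fiberOver f t) n) :=
  L t ⊓ LinearMap.range (tubeRestrict f n W t ht).hom

/-- **The local invariants have codimension `≤ d` at `s₁`**: for a morphism `j : U ⟶ P` (an open
immersion into a compactification, `s₁ ∈ P(ℂ)` typically a puncture) every neighbourhood `O` of
`s₁` contains a neighbourhood `O'` of `s₁` such that at every `t` with `j(t) ∈ O'`,
`dim L_t ≤ dim (localInvariants f n L (j(ℂ)⁻¹ O') t) + d`. For `d = 0`: trivial local monodromy at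
`s₁`; "`d ≤ dim End_flat(L)`" is the hypergeometric-type condition (a pseudo-reflection at `s₁` on
each constituent). [folklore] -/
def LocalInvariantCodimLE (f : 𝒳 ⟶ U) (n : ℕ)
    (L : ∀ t : ComplexPoints U, Submodule ℚ (bettiCohomology (fiberOver f t) n))
    {P : SchemeOver ℂ} (j : U ⟶ P) (s₁ : ComplexPoints P) (d : ℕ) : Prop :=
  ∀ O ∈ 𝓝 s₁, ∃ O' ∈ 𝓝 s₁, O' ⊆ O ∧ ∀ (t : ComplexPoints U) (ht : AlgPoints.map j t ∈ O'),
    Module.finrank ℚ (L t) ≤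
      Module.finrank ℚ (localInvariants f n L (AlgPoints.map j ⁻¹' O') t ht) + d

open scoped Classical in
/-- `L` **has finite monodromy**: there are finite spanning sets `F_t ⊆ L_t` forming a flat family,
i.e. locally on `U(ℂ)` each `F_t` is the injective image of one finite set `G` of classes on the
tube (parallel transport permutes a finite spanning set, which happens iff the monodromy group of
the sub-local system `L` is finite; Voisin I, §9.2.1; Voisin II, §3.2). Injectivity is asked on
`G` only; conjoin `IsFlatSubfamily f n L` when needed. [folklore] -/
def HasFiniteMonodromy (f : 𝒳 ⟶ U) (n : ℕ)
    (L : ∀ t : ComplexPoints U, Submodule ℚ (bettiCohomology (fiberOver f t) n)) : Prop :=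
  ∃ F : ∀ t : ComplexPoints U, Finset (bettiCohomology (fiberOver f t) n),
    (∀ t, Submodule.span ℚ (↑(F t) : Set (bettiCohomology (fiberOver f t) n)) = L t) ∧
    ∀ t₀ : ComplexPoints U, ∃ V ∈ 𝓝 t₀, ∃ G : Finset (singularCohomology ℚ ℚ (tube f V) n),
      ∀ (t : ComplexPoints U) (ht : t ∈ V),
        Finset.image (tubeRestrict f n V t ht).hom G = F t ∧
          Set.InjOn (tubeRestrict f n V t ht).hom ↑G

/-- A family of classes `y_s ∈ Hⁿ_B(𝒳_s)`, `s ∈ U(ℂ)`, **is a flat section** if locally on `U(ℂ)`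
it is the restriction of one class on the tube: a global section of the sheaf `Rⁿ f(ℂ)_* ℚ`
(the sheaf associated to `V ↦ Hⁿ(f⁻¹(V); ℚ)`, Voisin I, §9.2.1; Voisin II, §4.3.1). [folklore] -/
def IsFlatSection (f : 𝒳 ⟶ U) (n : ℕ)
    (y : ∀ s : ComplexPoints U, bettiCohomology (fiberOver f s) n) : Prop :=
  ∀ s₀ : ComplexPoints U, ∃ V ∈ 𝓝 s₀, ∃ g : singularCohomology ℚ ℚ (tube f V) n,
    ∀ (s : ComplexPoints U) (hs : s ∈ V), (tubeRestrict f n V s hs).hom g = y s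

section API

variable {f : 𝒳 ⟶ U} {g : 𝒦 ⟶ U} {n n' : ℕ}
  {L : ∀ t : ComplexPoints U, Submodule ℚ (bettiCohomology (fiberOver f t) n)}
  {L' : ∀ t : ComplexPoints U, Submodule ℚ (bettiCohomology (fiberOver g t) n')}

/-- A flat subfamily is flat over arbitrarily small neighbourhoods: the tube model over `V₀` pushes
forward to a tube model over any `V ⊆ V₀` (functoriality of restriction). [folklore] -/
theorem IsFlatSubfamily.exists_subset (hL : IsFlatSubfamily f n L) (t₀ : ComplexPoints U)
    {W : Set (ComplexPoints U)} (hW : W ∈ 𝓝 t₀) :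
    ∃ V ∈ 𝓝 t₀, V ⊆ W ∧ ∃ N : Submodule ℚ (singularCohomology ℚ ℚ (tube f V) n),
      ∀ (t : ComplexPoints U) (ht : t ∈ V),
        Submodule.map (tubeRestrict f n V t ht).hom N = L t ∧
          ∀ x ∈ N, (tubeRestrict f n V t ht).hom x = 0 → x = 0 := by
  obtain ⟨V₀, hV₀, N₀, hN₀⟩ := hL t₀
  refine ⟨V₀ ∩ W, Filter.inter_mem hV₀ hW, Set.inter_subset_right,
    N₀.map (singularCohomology.map ℚ ℚ (tubeIncl f Set.inter_subset_left) n).hom, fun t ht => ?_⟩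
  obtain ⟨hmap, hinj⟩ := hN₀ t ht.1
  refine ⟨?_, fun x hx h0 => ?_⟩
  · rw [← Submodule.map_comp, ← ModuleCat.hom_comp, map_tubeIncl_comp_tubeRestrict]
    exact hmap
  · obtain ⟨x₀, hx₀, rfl⟩ := Submodule.mem_map.1 hx
    rw [tubeRestrict_map_tubeIncl_apply] at h0
    rw [hinj x₀ hx₀ h0, map_zero]

/-- The zero family is a flat subfamily (tube model `N = 0` over all of `U(ℂ)`). [folklore] -/
theorem isFlatSubfamily_bot (f : 𝒳 ⟶ U) (n : ℕ) :
    IsFlatSubfamily f n fun t => (⊥ : Submodule ℚ (bettiCohomology (fiberOver f t) n)) :=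
  fun _ => ⟨Set.univ, Filter.univ_mem, ⊥, fun _ _ =>
    ⟨Submodule.map_bot _, fun _ hx _ => (Submodule.mem_bot ℚ).1 hx⟩⟩

/-- The source family of a flat morphism is a flat subfamily. [folklore] -/
theorem IsFlatHom.isFlatSubfamily_left {φ : ∀ t, L t →ₗ[ℚ] L' t}
    (h : IsFlatHom f g n n' L L' φ) : IsFlatSubfamily f n L := fun t₀ => by
  obtain ⟨V, hV, N, N', Φ, hN⟩ := h t₀
  exact ⟨V, hV, N, fun t ht => ⟨(hN t ht).1, (hN t ht).2.1⟩⟩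

/-- The target family of a flat morphism is a flat subfamily. [folklore] -/
theorem IsFlatHom.isFlatSubfamily_right {φ : ∀ t, L t →ₗ[ℚ] L' t}
    (h : IsFlatHom f g n n' L L' φ) : IsFlatSubfamily g n' L' := fun t₀ => by
  obtain ⟨V, hV, N, N', Φ, hN⟩ := h t₀
  exact ⟨V, hV, N', fun t ht => ⟨(hN t ht).2.2.1, (hN t ht).2.2.2.1⟩⟩

/-- A flat endomorphism family (one-subspace form) is a flat morphism `L → L`. [folklore] -/
theorem IsFlatEnd.isFlatHom {ψ : ∀ t, L t →ₗ[ℚ] L t} (h : IsFlatEnd f n L ψ) :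
    IsFlatHom f f n n L L ψ := fun t₀ => by
  obtain ⟨V, hV, N, Ψ, hN⟩ := h t₀
  exact ⟨V, hV, N, N, Ψ, fun t ht =>
    ⟨(hN t ht).1, (hN t ht).2.1, (hN t ht).1, (hN t ht).2.1, (hN t ht).2.2⟩⟩

/-- Flat endomorphism families lie in `flatEndSpan`. [folklore] -/
theorem IsFlatEnd.mem_flatEndSpan {ψ : ∀ t, L t →ₗ[ℚ] L t} (h : IsFlatEnd f n L ψ) :
    ψ ∈ flatEndSpan f n L := Submodule.subset_span h

/-- The invariants over `W` are classes of `L_t`. [folklore] -/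
theorem localInvariants_le (W : Set (ComplexPoints U)) (t : ComplexPoints U) (ht : t ∈ W) :
    localInvariants f n L W t ht ≤ L t := inf_le_left

/-- The codimension bound is monotone in `d`. [folklore] -/
theorem LocalInvariantCodimLE.mono {P : SchemeOver ℂ} {j : U ⟶ P} {s₁ : ComplexPoints P}
    {d d' : ℕ} (h : LocalInvariantCodimLE f n L j s₁ d) (hd : d ≤ d') :
    LocalInvariantCodimLE f n L j s₁ d' := fun O hO => by
  obtain ⟨O', hO', hsub, hO't⟩ := h O hO
  exact ⟨O', hO', hsub, fun t ht => (hO't t ht).trans (Nat.add_le_add_left hd _)⟩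

/-- The zero family has finite monodromy (empty spanning sets). [folklore] -/
theorem hasFiniteMonodromy_bot (f : 𝒳 ⟶ U) (n : ℕ) :
    HasFiniteMonodromy f n fun t => (⊥ : Submodule ℚ (bettiCohomology (fiberOver f t) n)) :=
  ⟨fun _ => ∅, fun _ => by simp, fun _ => ⟨Set.univ, Filter.univ_mem, ∅, fun _ _ => by simp⟩⟩

/-- Restrictions of a global class `z ∈ Hⁿ(𝒳(ℂ); ℚ)` to the fibres form a flat section (the easy
half of the theorem of the fixed part; Voisin II, §4.3.1). [folklore] -/
theorem isFlatSection_map_fiberι (f : 𝒳 ⟶ U) (n : ℕ) (z : bettiCohomology 𝒳 n) :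
    IsFlatSection f n fun s => (bettiCohomology.map (fiberι f s) n).hom z :=
  fun _ => ⟨Set.univ, Filter.univ_mem, (singularCohomology.map ℚ ℚ (tubeVal f Set.univ) n).hom z,
    fun s hs => tubeRestrict_map_tubeVal_apply f n Set.univ s hs z⟩

/-- Flat sections are stable under addition (common refinement of the two tubes). [folklore] -/
theorem IsFlatSection.add {y y' : ∀ s : ComplexPoints U, bettiCohomology (fiberOver f s) n}
    (hy : IsFlatSection f n y) (hy' : IsFlatSection f n y') :
    IsFlatSection f n fun s => y s + y' s := fun s₀ => by
  obtain ⟨V, hV, g, hg⟩ := hy s₀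
  obtain ⟨V', hV', g', hg'⟩ := hy' s₀
  refine ⟨V ∩ V', Filter.inter_mem hV hV',
    (singularCohomology.map ℚ ℚ (tubeIncl f Set.inter_subset_left) n).hom g +
      (singularCohomology.map ℚ ℚ (tubeIncl f Set.inter_subset_right) n).hom g',
    fun s hs => ?_⟩
  rw [map_add, tubeRestrict_map_tubeIncl_apply, tubeRestrict_map_tubeIncl_apply, hg s hs.1,
    hg' s hs.2]

/-- Flat sections are stable under scalars. [folklore] -/
theorem IsFlatSection.smul {y : ∀ s : ComplexPoints U, bettiCohomology (fiberOver f s) n}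
    (hy : IsFlatSection f n y) (c : ℚ) : IsFlatSection f n fun s => c • y s := fun s₀ => by
  obtain ⟨V, hV, g, hg⟩ := hy s₀
  exact ⟨V, hV, c • g, fun s hs => by rw [map_smul, hg s hs]⟩

end API

/-- **Ehresmann's theorem on tubes.** Let `U` be smooth over `ℂ` and `f : 𝒳 ⟶ U` smooth and
proper, so that `f(ℂ) : 𝒳(ℂ) → U(ℂ)` is a proper holomorphic submersion of complex manifolds.
Then every neighbourhood `W` of every `t₀ ∈ U(ℂ)` contains a neighbourhood `V` of `t₀` over which
all the tube restrictions `Hⁿ(tube f V; ℚ) → Hⁿ(𝒳_t(ℂ); ℚ)`, `t ∈ V`, are isomorphisms. Printed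
form: a proper submersion over a contractible base `B ∋ 0` is diffeomorphic over `B` to
`X_0 × B` (Voisin I, Thm. 9.3), hence `Hᵏ(X_0 × B_0, A) ≅ Hᵏ(X_0, A)` for a fundamental system of
(contractible) neighbourhoods `B_0`, the stalk at `t` being `Hᵏ(X_t, A)` by restriction (Voisin I,
§9.2.1). The rendering uses that `tube f V` is `f(ℂ)⁻¹(V)` with its analytic topology.
[cite: VoisinHodgeI2002, Thm. 9.3 and §9.2.1] -/
def Voisin2002_tubeRestrict_isIso : Prop :=
  ∀ ⦃U 𝒳 : SchemeOver ℂ⦄ (f : 𝒳 ⟶ U) (n : ℕ), AlgebraicGeometry.Smooth U.hom →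
    AlgebraicGeometry.Smooth f.left → IsProper f.left →
    ∀ (t₀ : ComplexPoints U), ∀ W ∈ 𝓝 t₀, ∃ V ∈ 𝓝 t₀, V ⊆ W ∧
      ∀ (t : ComplexPoints U) (ht : t ∈ V), IsIso (tubeRestrict f n V t ht)

/-- **Global sections of `Rⁿ f_* ℚ` come from the total space** (Deligne; Voisin II, Thm. 4.18 and
its proof): for `φ : X → Y` a projective (Voisin II, Def. 4.14: a closed embedding
`X ↪ Y × ℙᵐ` over `Y`) and submersive morphism of complex manifolds, the Leray spectral sequence
degenerates (Thm. 4.15) and the restriction map `Hᵏ(X, ℚ) → Γ(Y, Rᵏ φ_* ℚ)` is surjective; with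
Lemma 4.17 this is the surjection `Hᵏ(X, ℚ) → Hᵏ(X_y, ℚ)^{inv}` onto the monodromy invariants.
Rendered on tubes: for `U` smooth, quasi-compact and separated over `ℂ` (so that `U(ℂ)` is a
complex manifold) and `f : 𝒳 ⟶ U` smooth and projective over `U`, every flat section `y`
(`IsFlatSection`: a global section of `Rⁿ f(ℂ)_* ℚ`) is the family of restrictions of one class
`z ∈ Hⁿ(𝒳(ℂ); ℚ)`. (The finer statement with a smooth compactification `X̄`, Deligne 1971,
4.1.1 / Voisin II, Thm. 4.24, is not recorded here.)
[cite: VoisinHodgeII2003, Thm. 4.18 (with Def. 4.14, Thm. 4.15, Lemma 4.17)] -/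
def Voisin2003_invariantCycles : Prop :=
  ∀ ⦃U 𝒳 : SchemeOver ℂ⦄ (f : 𝒳 ⟶ U) (n : ℕ), AlgebraicGeometry.Smooth U.hom →
    QuasiCompact U.hom → IsSeparated U.hom → AlgebraicGeometry.Smooth f.left →
    (∃ (m : ℕ) (ι : 𝒳 ⟶ U ⊗ projectiveSpace m ℂ),
      IsClosedImmersion ι.left ∧ ι ≫ CartesianMonoidalCategory.fst U (projectiveSpace m ℂ) = f) →
    ∀ y : (∀ s : ComplexPoints U, bettiCohomology (fiberOver f s) n), IsFlatSection f n y →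
      ∃ z : bettiCohomology 𝒳 n,
        ∀ s : ComplexPoints U, (bettiCohomology.map (fiberι f s) n).hom z = y s

end Literature.AlgebraicGeometry.Motives

end
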